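import Literature.NumberTheory.Automorphic.ThorneQInfinityModularTheorem2Proofs
import Literature.NumberTheory.Automorphic.FLSResidualImageCriteriaProofs
import HarnessLib

/-!
# Box 2022, Theorem 1.3 from its five printed inputs (proofs only)

Sibling PROOFS file of `TotallyRealModularityBoxImages.lean` (theorems only: no definition, no
named fact; D-0014 / D-0026). It reduces the named fact `Box2022_theorem1_3` — "Suppose that `E`
is a non-modular elliptic curve over a totally real field `K`. Then (i) `Im(ρ̄_{E,3})` is
conjugate to a subgroup of `C_s⁺(3)` or `B(3)`, (ii) if `√5 ∉ K`, then `Im(ρ̄_{E,5})` is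
conjugate to a subgroup of `B(5)`, and (iii) if `K ∩ ℚ(ζ₇) = ℚ`, then `Im(ρ̄_{E,7})` is conjugate
to a subgroup of `B(7)` or `G(e7)`" — to the theorems its printed proof cites, all of which are
now in the tree either as named facts (`FLS2015_theorem3`, `FLS2015_theorem4`, `FLS2015_prop9_1c`,
`Kalyanswamy2018_theorem1_2`, file `FLSResidualImageCriteria.lean`) or, for (ii) = Thorne 2016,
Thm. 7.6, as the theorem `Thorne2016_theorem7_6_of_dihedralLifting` of
`ThorneQInfinityModularTheorem2Proofs.lean` (from `FLS2015_theorem3` and Thorne 2016, Thm. 7.5,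
the written-out hypothesis (T) of that file).

## The printed proof (held text `paper:arxiv-2103.13975`, p. 4)

J. Box, *Elliptic curves over totally real quartic fields not containing `√5` are modular*, Trans.
Amer. Math. Soc. 375 (2022) [Box2022], proof of Thm. 1.3 (verbatim): "Part (i) is a consequence of
modularity lifting theorems due amongst others to Breuil and Diamond [bd], which show that the
restriction of `ρ̄_{E,3}` to `Gal(K̄/K(ζ₃))` is absolutely reducible. See [freitas] for more
details. It then follows from [rubin] that `ρ̄_{E,3}` is conjugate to a subgroup of `C_s⁺(3)` or
`B(3)`. Part (ii) was shown by Thorne [thorne]. In [kalyanswamy], Kalyanswami shows that if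
`ζ₇ + ζ₇⁻¹ ∉ K`, then `Im(ρ̄_{E,7})` is conjugate to a subgroup of either `B(7)` or `C_ns⁺(7)`. In
the latter case, Freitas, Le Hung and Siksek study the subgroups of `C_ns⁺(7)` and show in
[freitas] that in fact the image must be contained in the index 2 subgroup `G(e7)`."  Here
`C_s⁺(p)` = "the normaliser of a split Cartan subgroup", `G(e7) := ⟨(0 5; 3 0), (5 0; 3 2)⟩`
(§1.2, same page).

## What is proved

* (i): `FLS2015.mod3_dichotomy_of_not_isAutomorphicOfWeightZero` (from `FLS2015_theorem3` and the
  PROVED Prop. 9.1 (a)) gives a reducible framing — made upper triangular by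
  `FLS2015.exists_isTorsionGaloisRep_borel_of_not_isIrreducible` — or a framing `ρ̄` with image
  the normaliser of a split Cartan subgroup `P (* 0; 0 *) P⁻¹`; the conjugate framing `P⁻¹ ρ̄ P`
  takes diagonal or antidiagonal values (`Serre1972.mem_normalizer_splitCartan_iff`), which lie
  in `⟨diag(1,2), (0 1; 1 0)⟩`, the `C_s⁺(3)` written in `Box2022_theorem1_3`
  (`Box2022.mem_closure_Cs3_of_isDg_or_isAd`, a check on the eight monomial matrices of `GL₂(𝔽₃)`).
* (ii): `Box2022_theorem1_3_five_of_theorem7_6` (the sibling file).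
* (iii): the hypothesis "`X³ + X² - 2X - 1` has no root in `K`" of the fact (the minimal
  polynomial of `ζ₇ + ζ₇⁻¹`; Box: "if `ζ₇ + ζ₇⁻¹ ∉ K`") gives `χ̄₇` onto on `Γ_K`
  (`Box2022.modPCyclotomicCharacterZMod_seven_surjective_of_forall_ne`, the argument of the tree's
  `modPCyclotomicCharacterZMod_seven_surjective` with the root itself in place of the degree), and
  `FLS2015.mod7_dichotomy_of_not_isAutomorphicOfWeightZero` (from `FLS2015_theorem4`,
  `FLS2015_prop9_1c`, `Kalyanswamy2018_theorem1_2`) gives a reducible framing or one conjugate into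
  `FLS2015.subgroupE7 = G(e7)` (the same two generators, token for token).
* Assembly: `Box2022_theorem1_3_of_theorem7_6` (inputs: the four facts and any proof of Thm. 7.6 on
  the strong carrier) and `Box2022_theorem1_3_of_liftingTheorems` (inputs: the four facts and
  hypothesis (T) = Thorne 2016, Thm. 7.5 for `ρ_{E,p}`). Consequently the discharge of
  `Box2022_theorem1_3` is EXACTLY the discharge of `FLS2015_theorem3`, `FLS2015_theorem4`,
  `FLS2015_prop9_1c` (triage M: finite group theory), `Kalyanswamy2018_theorem1_2` and a vendored
  (T); no part of it is circular any more (cf. Part I of the sibling file).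

## References

* [Box2022] Trans. Amer. Math. Soc. 375 (2022), Thm. 1.3 and its proof, §1.2 — held
  `paper:arxiv-2103.13975`, p. 4 of the text.
* [FreitasLeHungSiksek2015] Invent. Math. 201 (2015), Thms. 3–4, Prop. 9.1; [Kalyanswamy2018]
  Math. Res. Lett. 25 (2018), Thm. 1.2; [Thorne2016] Math. Ann. 364 (2016), Thms. 7.5–7.6;
  [Serre1972] Invent. Math. 15 (1972), §2.2 (normaliser of a split Cartan subgroup).
-/

open scoped NumberField MatrixGroups
open NumberField Field Matrix Polynomial Literature.NumberTheory.GaloisRepresentations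

noncomputable section

namespace Literature.NumberTheory.Automorphic

namespace Box2022

universe u

/-! ### `C_s⁺(3) = ⟨diag(1,2), (0 1; 1 0)⟩`: diagonal and antidiagonal elements of `GL₂(𝔽₃)` -/

/-- **Diagonal elements of `GL₂(𝔽₃)` lie in `⟨diag(1,2), (0 1; 1 0)⟩`.** The four invertible
diagonal matrices over `𝔽₃` are `1`, `a = diag(1,2)`, `w a w = diag(2,1)` and
`a w a w = diag(2,2)` for `w = (0 1; 1 0)`. [folklore] -/
theorem mem_closure_Cs3_of_isDg {g : GL (Fin 2) (ZMod 3)}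
    (hg : GL2.IsDg ((g : GL (Fin 2) (ZMod 3)) : Matrix (Fin 2) (Fin 2) (ZMod 3))) :
    g ∈ Subgroup.closure ({(⟨!![1, 0; 0, 2], !![1, 0; 0, 2], by decide, by decide⟩ :
          GL (Fin 2) (ZMod 3)),
        (⟨!![0, 1; 1, 0], !![0, 1; 1, 0], by decide, by decide⟩ : GL (Fin 2) (ZMod 3))} :
        Set (GL (Fin 2) (ZMod 3))) := by
  set a : GL (Fin 2) (ZMod 3) := ⟨!![1, 0; 0, 2], !![1, 0; 0, 2], by decide, by decide⟩ with ha
  set w : GL (Fin 2) (ZMod 3) := ⟨!![0, 1; 1, 0], !![0, 1; 1, 0], by decide, by decide⟩ with hw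
  set S := Subgroup.closure ({a, w} : Set (GL (Fin 2) (ZMod 3))) with hS
  have haS : a ∈ S := Subgroup.subset_closure (Set.mem_insert _ _)
  have hwS : w ∈ S := Subgroup.subset_closure (Set.mem_insert_of_mem _ (Set.mem_singleton _))
  -- entries of `g`
  have hdet : ((g : GL (Fin 2) (ZMod 3)) : Matrix (Fin 2) (Fin 2) (ZMod 3)).det ≠ 0 :=
    GL2.det_ne_zero g
  rw [Matrix.det_fin_two, hg.1, zero_mul, sub_zero] at hdet
  have h00 : (g : Matrix (Fin 2) (Fin 2) (ZMod 3)) 0 0 ≠ 0 := left_ne_zero_of_mul hdet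
  have h11 : (g : Matrix (Fin 2) (Fin 2) (ZMod 3)) 1 1 ≠ 0 := right_ne_zero_of_mul hdet
  have key : ∀ x : ZMod 3, x ≠ 0 → x = 1 ∨ x = 2 := by decide
  have hshape : ∀ d : GL (Fin 2) (ZMod 3),
      (d : Matrix (Fin 2) (Fin 2) (ZMod 3)) 0 0 = (g : Matrix (Fin 2) (Fin 2) (ZMod 3)) 0 0 →
      (d : Matrix (Fin 2) (Fin 2) (ZMod 3)) 1 1 = (g : Matrix (Fin 2) (Fin 2) (ZMod 3)) 1 1 →
      (d : Matrix (Fin 2) (Fin 2) (ZMod 3)) 0 1 = 0 →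
      (d : Matrix (Fin 2) (Fin 2) (ZMod 3)) 1 0 = 0 → d ∈ S → g ∈ S := by
    intro d h0 h1 h01 h10 hd
    have : g = d := by
      refine Units.ext (Matrix.ext fun i j => ?_)
      fin_cases i <;> fin_cases j
      · exact h0.symm
      · change (g : Matrix (Fin 2) (Fin 2) (ZMod 3)) 0 1 = (d : Matrix (Fin 2) (Fin 2) (ZMod 3)) 0 1
        rw [hg.1, h01]
      · change (g : Matrix (Fin 2) (Fin 2) (ZMod 3)) 1 0 = (d : Matrix (Fin 2) (Fin 2) (ZMod 3)) 1 0
        rw [hg.2, h10]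
      · exact h1.symm
    rw [this]; exact hd
  rcases key _ h00 with h0 | h0 <;> rcases key _ h11 with h1 | h1
  · exact hshape 1 (by rw [h0]; rfl) (by rw [h1]; rfl) rfl rfl S.one_mem
  · exact hshape a (by rw [h0]; rfl) (by rw [h1]; rfl) rfl rfl haS
  · have hwaw : w * a * w = ⟨!![2, 0; 0, 1], !![2, 0; 0, 1], by decide, by decide⟩ := by decide
    exact hshape (w * a * w) (by rw [h0, hwaw]; rfl) (by rw [h1, hwaw]; rfl) (by rw [hwaw]; rfl)
      (by rw [hwaw]; rfl) (S.mul_mem (S.mul_mem hwS haS) hwS)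
  · have haa : a * (w * a * w) = ⟨!![2, 0; 0, 2], !![2, 0; 0, 2], by decide, by decide⟩ := by
      decide
    exact hshape (a * (w * a * w)) (by rw [h0, haa]; rfl) (by rw [h1, haa]; rfl) (by rw [haa]; rfl)
      (by rw [haa]; rfl) (S.mul_mem haS (S.mul_mem (S.mul_mem hwS haS) hwS))

/-- **`C_s⁺(3)`: every diagonal or antidiagonal element of `GL₂(𝔽₃)` lies in
`⟨diag(1,2), (0 1; 1 0)⟩`** (an antidiagonal `g` is `(g w) w` with `g w` diagonal). With
`Serre1972.mem_normalizer_splitCartan_iff` this identifies the normaliser of the diagonal split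
Cartan subgroup of `GL₂(𝔽₃)` (order `8`) with the group written in `Box2022_theorem1_3` (i) and in
FLS Prop. 9.1 (a) ("`C_s⁺(3)` … this has order `8`"). [cite: Box2022, §1.2 and Thm. 1.3 (i)] -/
theorem mem_closure_Cs3_of_isDg_or_isAd {g : GL (Fin 2) (ZMod 3)}
    (hg : GL2.IsDg ((g : GL (Fin 2) (ZMod 3)) : Matrix (Fin 2) (Fin 2) (ZMod 3)) ∨
      GL2.IsAd ((g : GL (Fin 2) (ZMod 3)) : Matrix (Fin 2) (Fin 2) (ZMod 3))) :
    g ∈ Subgroup.closure ({(⟨!![1, 0; 0, 2], !![1, 0; 0, 2], by decide, by decide⟩ :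
          GL (Fin 2) (ZMod 3)),
        (⟨!![0, 1; 1, 0], !![0, 1; 1, 0], by decide, by decide⟩ : GL (Fin 2) (ZMod 3))} :
        Set (GL (Fin 2) (ZMod 3))) := by
  rcases hg with hg | hg
  · exact mem_closure_Cs3_of_isDg hg
  · set w : GL (Fin 2) (ZMod 3) := ⟨!![0, 1; 1, 0], !![0, 1; 1, 0], by decide, by decide⟩ with hw
    have hwS : w ∈ Subgroup.closure ({(⟨!![1, 0; 0, 2], !![1, 0; 0, 2], by decide, by decide⟩ :
          GL (Fin 2) (ZMod 3)), w} : Set (GL (Fin 2) (ZMod 3))) :=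
      Subgroup.subset_closure (Set.mem_insert_of_mem _ (Set.mem_singleton _))
    -- `g w` is diagonal
    have hgw : GL2.IsDg (((g * w : GL (Fin 2) (ZMod 3))) : Matrix (Fin 2) (Fin 2) (ZMod 3)) := by
      constructor
      · simp [Units.val_mul, hw, Matrix.mul_apply, Fin.sum_univ_two, hg.1]
      · simp [Units.val_mul, hw, Matrix.mul_apply, Fin.sum_univ_two, hg.2]
    have hww : w * w = 1 := by decide
    have : g = g * w * w := by rw [mul_assoc, hww, mul_one]
    rw [this]
    exact Subgroup.mul_mem _ (mem_closure_Cs3_of_isDg hgw) hwS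

/-! ### `χ̄₇` is onto when `X³ + X² - 2X - 1` has no root in `K` -/

/-- **`χ̄₇` is onto on `Γ_K` when `ζ₇ + ζ₇⁻¹ ∉ K`**, for a field `K` of characteristic zero with a
real embedding, the hypothesis being phrased as in `Box2022_theorem1_3` (iii): the cubic
`X³ + X² - 2X - 1` (minimal polynomial of `ζ₇ + ζ₇⁻¹`) has no root in `K`. Otherwise `χ̄₇ = ±1` on
`Γ_K` (`modPCyclotomicCharacterZMod_eq_one_or_eq_neg_one_of_not_surjective`), so the period
`η = ζ + ζ⁶` of a primitive seventh root of unity `ζ ∈ K̄` is fixed by `Γ_K`, lies in `K`, and is a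
root of the cubic. (Box: "(iii) if `K ∩ ℚ(ζ₇) = ℚ`", proof: "if `ζ₇ + ζ₇⁻¹ ∉ K`"; the argument of
the tree's `modPCyclotomicCharacterZMod_seven_surjective`.) [cite: Box2022, Thm. 1.3 (iii) and its proof] -/
theorem modPCyclotomicCharacterZMod_seven_surjective_of_forall_ne (K : Type u) [Field K]
    [CharZero K] [Fact (Nat.Prime 7)] (φ : K →+* ℝ)
    (hK : ∀ x : K, x ^ 3 + x ^ 2 - 2 * x - 1 ≠ 0) :
    Function.Surjective (modPCyclotomicCharacterZMod K 7) := by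
  by_contra hs
  have hpm := modPCyclotomicCharacterZMod_eq_one_or_eq_neg_one_of_not_surjective K 7
    ZMod.exists_eq_pow_mul_neg_one_pow_seven φ hs
  haveI : NeZero ((7 : ℕ) : K) := NeZero.charZero
  obtain ⟨ζ, hζ⟩ := HasEnoughRootsOfUnity.exists_primitiveRoot (AlgebraicClosure K) 7
  have h1 : ζ ^ 7 = 1 := hζ.pow_eq_one
  have hΦ : 1 + ζ + ζ ^ 2 + ζ ^ 3 + ζ ^ 4 + ζ ^ 5 + ζ ^ 6 = 0 := by
    have := hζ.geom_sum_eq_zero (by norm_num : 1 < 7)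
    simp only [Finset.sum_range_succ, Finset.sum_range_zero, zero_add, pow_zero, pow_one] at this
    exact this
  set η : AlgebraicClosure K := ζ + ζ ^ 6 with hη
  have hfix : ∀ σ : absoluteGaloisGroup K, σ • η = η := by
    intro σ
    rcases smul_eq_self_or_eq_pow_of_eq_one_or_eq_neg_one K 7 h1 (hpm σ) with hσ | hσ
    · simp only [hη, smul_add, smul_pow', hσ]
    · simp only [hη, smul_add, smul_pow', hσ, ← pow_mul]
      norm_num
      linear_combination (ζ ^ 29 + ζ ^ 22 + ζ ^ 15 + ζ ^ 8 + ζ) * h1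
  obtain ⟨x, hx⟩ := mem_range_algebraMap_of_forall_smul_eq K hfix
  have hη3 : η ^ 3 + η ^ 2 - 2 * η - 1 = 0 := by
    simp only [hη]
    linear_combination
      (ζ ^ 12 - ζ ^ 11 + 3 * ζ ^ 7 - 2 * ζ ^ 6 - ζ ^ 4 + 3 * ζ ^ 2 - ζ - 1) * hΦ
  refine hK x ((algebraMap K (AlgebraicClosure K)).injective ?_)
  rw [map_sub, map_sub, map_add, map_pow, map_pow, map_mul, map_ofNat, map_one, map_zero, hx]
  exact hη3

/-! ### Clause (i): `p = 3` -/

/-- **Box 2022, Thm. 1.3 (i) from FLS Thm. 3 (and the proved Prop. 9.1 (a)).** For a non-modular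
`E / 𝓞 K` (`K` totally real, `Δ ≠ 0`, `¬ IsAutomorphicOfWeightZero E`) some framing of `E[3]` has
image in `B(3)` (entry `(1,0)` zero) or in `C_s⁺(3) = ⟨diag(1,2), (0 1; 1 0)⟩`: by
`FLS2015.mod3_dichotomy_of_not_isAutomorphicOfWeightZero` some framing `ρ̄` is reducible — then a
conjugate framing is upper triangular — or has image the normaliser of a split Cartan subgroup
`P (* 0; 0 *) P⁻¹` — then the conjugate framing `P⁻¹ ρ̄ P` (`FLS2015.isTorsionGaloisRep_conj`) is
diagonal-or-antidiagonal valued (`Serre1972.mem_normalizer_splitCartan_iff`), i.e. lands in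
`⟨diag(1,2), (0 1; 1 0)⟩` (`mem_closure_Cs3_of_isDg_or_isAd`). Printed: "Part (i) … [bd] …
[freitas] … It then follows from [rubin] that `ρ̄_{E,3}` is conjugate to a subgroup of `C_s⁺(3)`
or `B(3)`." [cite: Box2022, Thm. 1.3 (i) and its proof] [cite: FreitasLeHungSiksek2015, Thm. 3 and Prop. 9.1 (a)] -/
theorem clause_three (h3 : FLS2015_theorem3) (K : Type) [Field K] [NumberField K]
    [IsTotallyReal K] (E : WeierstrassCurve (𝓞 K)) (hΔ : E.Δ ≠ 0)
    (hne : ¬ IsAutomorphicOfWeightZero E) :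
    ∃ ρ : FramedGaloisRep K (ZMod 3) 2, (E.baseChange K).IsTorsionGaloisRep 3 ρ ∧
      ((∀ σ : Field.absoluteGaloisGroup K,
          ((ρ σ : GL (Fin 2) (ZMod 3)) : Matrix (Fin 2) (Fin 2) (ZMod 3)) 1 0 = 0) ∨
        (∀ σ : Field.absoluteGaloisGroup K, (ρ σ : GL (Fin 2) (ZMod 3)) ∈
          Subgroup.closure ({(⟨!![1, 0; 0, 2], !![1, 0; 0, 2], by decide, by decide⟩ :
              GL (Fin 2) (ZMod 3)),
            (⟨!![0, 1; 1, 0], !![0, 1; 1, 0], by decide, by decide⟩ : GL (Fin 2) (ZMod 3))} :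
            Set (GL (Fin 2) (ZMod 3))))) := by
  have hF : ∃ u : (ZMod 3)ˣ, u ≠ 1 := ⟨-1, by decide⟩
  haveI : Fact (Nat.Prime 3) := ⟨by norm_num⟩
  obtain ⟨ρ, hρ, h⟩ := FLS2015.mod3_dichotomy_of_not_isAutomorphicOfWeightZero h3 K E hΔ hne
  rcases h with hnirr | ⟨P, hP⟩
  · obtain ⟨ρ', hρ', hB⟩ := FLS2015.exists_isTorsionGaloisRep_borel_of_not_isIrreducible hρ hnirr
    exact ⟨ρ', hρ', Or.inl hB⟩
  · refine ⟨FramedRep.conj P⁻¹ ρ, FLS2015.isTorsionGaloisRep_conj hρ P⁻¹, Or.inr fun σ => ?_⟩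
    have hmem : ρ σ ∈ Subgroup.normalizer (Serre1972.splitCartan P : Set (GL (Fin 2) (ZMod 3))) := by
      rw [← hP]; exact ⟨σ, rfl⟩
    have h := (Serre1972.mem_normalizer_splitCartan_iff hF).mp hmem
    rw [FramedRep.conj_apply, inv_inv]
    exact mem_closure_Cs3_of_isDg_or_isAd h

/-! ### Clause (iii): `p = 7` -/

/-- **Box 2022, Thm. 1.3 (iii) from FLS Thm. 4, FLS Prop. 9.1 (c) and Kalyanswamy's Thm. 1.2.**
For a non-modular `E / 𝓞 K` (`K` totally real, `Δ ≠ 0`) over a field in which `X³ + X² - 2X - 1`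
has no root, some framing of `E[7]` has image in `B(7)` or in `G(e7) = ⟨(0 5; 3 0), (5 0; 3 2)⟩`:
`χ̄₇` is onto (`modPCyclotomicCharacterZMod_seven_surjective_of_forall_ne`), so
`FLS2015.mod7_dichotomy_of_not_isAutomorphicOfWeightZero` gives a reducible framing (made upper
triangular by a change of framing) or a framing conjugate into `FLS2015.subgroupE7`, which IS the
`G(e7)` of the fact; the conjugate framing is again a framing (`FLS2015.isTorsionGaloisRep_conj`).
Printed: "In [kalyanswamy], Kalyanswami shows that if `ζ₇ + ζ₇⁻¹ ∉ K`, then `Im(ρ̄_{E,7})` is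
conjugate to a subgroup of either `B(7)` or `C_ns⁺(7)`. … in fact the image must be contained in
the index 2 subgroup `G(e7)`." [cite: Box2022, Thm. 1.3 (iii) and its proof] [cite: Kalyanswamy2018, Thm. 1.2] [cite: FreitasLeHungSiksek2015, Thm. 4 and Prop. 9.1 (c)] -/
theorem clause_seven (h4 : FLS2015_theorem4) (h91 : FLS2015_prop9_1c)
    (hKal : Kalyanswamy2018_theorem1_2) (K : Type) [Field K] [NumberField K] [IsTotallyReal K]
    (E : WeierstrassCurve (𝓞 K)) (hΔ : E.Δ ≠ 0) (hne : ¬ IsAutomorphicOfWeightZero E)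
    (hcubic : ∀ x : K, x ^ 3 + x ^ 2 - 2 * x - 1 ≠ 0) :
    ∃ ρ : FramedGaloisRep K (ZMod 7) 2, (E.baseChange K).IsTorsionGaloisRep 7 ρ ∧
      ((∀ σ : Field.absoluteGaloisGroup K,
          ((ρ σ : GL (Fin 2) (ZMod 7)) : Matrix (Fin 2) (Fin 2) (ZMod 7)) 1 0 = 0) ∨
        (∀ σ : Field.absoluteGaloisGroup K, (ρ σ : GL (Fin 2) (ZMod 7)) ∈
          Subgroup.closure ({(⟨!![0, 5; 3, 0], !![0, 5; 3, 0], by decide, by decide⟩ :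
              GL (Fin 2) (ZMod 7)),
            (⟨!![5, 0; 3, 2], !![3, 0; 6, 4], by decide, by decide⟩ : GL (Fin 2) (ZMod 7))} :
            Set (GL (Fin 2) (ZMod 7))))) := by
  haveI : Fact (Nat.Prime 7) := ⟨by norm_num⟩
  obtain ⟨φ⟩ := FLS2015.exists_realEmbedding K
  have hK : Function.Surjective (modPCyclotomicCharacterZMod K 7) :=
    modPCyclotomicCharacterZMod_seven_surjective_of_forall_ne K φ hcubic
  obtain ⟨ρ, hρ, h⟩ :=
    FLS2015.mod7_dichotomy_of_not_isAutomorphicOfWeightZero h4 h91 hKal K hK E hΔ hne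
  rcases h with hnirr | ⟨P, hP⟩
  · obtain ⟨ρ', hρ', hB⟩ := FLS2015.exists_isTorsionGaloisRep_borel_of_not_isIrreducible hρ hnirr
    exact ⟨ρ', hρ', Or.inl hB⟩
  · refine ⟨FramedRep.conj P ρ, FLS2015.isTorsionGaloisRep_conj hρ P, Or.inr fun σ => ?_⟩
    rw [FramedRep.conj_apply]
    exact hP σ

end Box2022

/-! ### Box 2022, Thm. 1.3 from the five printed inputs -/

/-- **Box 2022, Theorem 1.3 from its printed inputs, with (ii) supplied by any proof of Thorne
2016, Thm. 7.6 on the strong carrier.** Inputs: `FLS2015_theorem3` ((i), and (ii) through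
Thm. 7.6), `FLS2015_theorem4`, `FLS2015_prop9_1c`, `Kalyanswamy2018_theorem1_2` ((iii)), and
`h76` = "`F` totally real, `√5 ∉ F`, `E / 𝓞 F` with `Δ ≠ 0` and `E[5]` irreducible ⇒
`IsAutomorphicOfWeightZero E`" ((ii), via `Box2022_theorem1_3_five_of_theorem7_6`). Clauses (i) and
(iii) are `Box2022.clause_three`, `Box2022.clause_seven`.
[cite: Box2022, Thm. 1.3 and its proof] -/
theorem Box2022_theorem1_3_of_theorem7_6 (h3 : FLS2015_theorem3) (h4 : FLS2015_theorem4)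
    (h91 : FLS2015_prop9_1c) (hKal : Kalyanswamy2018_theorem1_2)
    (h76 : ∀ (F : Type) [Field F] [NumberField F] [IsTotallyReal F], ¬ IsSquare (5 : F) →
      ∀ E : WeierstrassCurve (𝓞 F), E.Δ ≠ 0 → (E.baseChange F).HasIrreducibleModPGaloisRep 5 →
        IsAutomorphicOfWeightZero E) :
    Box2022_theorem1_3 := by
  intro K _ _ _ E hΔ hne
  exact ⟨Box2022.clause_three h3 K E hΔ hne,
    fun h5 => Box2022_theorem1_3_five_of_theorem7_6 h76 K E hΔ hne h5,
    fun hcubic => Box2022.clause_seven h4 h91 hKal K E hΔ hne hcubic⟩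

/-- **`Box2022_theorem1_3` closed modulo five printed lifting inputs**: `FLS2015_theorem3`,
`FLS2015_theorem4`, `FLS2015_prop9_1c`, `Kalyanswamy2018_theorem1_2` (named facts of
`FLSResidualImageCriteria.lean`) and hypothesis (T) = Thorne 2016, Thm. 7.5 for `ρ_{E,p}`
(written out; module docstring of `ThorneQInfinityModularTheorem2Proofs.lean`), through
`Thorne2016_theorem7_6_of_dihedralLifting`. This is the printed proof of Thm. 1.3 in full: "(i) …
[bd] … [freitas] … [rubin] …; Part (ii) was shown by Thorne [thorne]; (iii) … [kalyanswamy] …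
[freitas]". [cite: Box2022, Thm. 1.3 and its proof] [cite: Thorne2016, Thms. 7.5, 7.6] -/
theorem Box2022_theorem1_3_of_liftingTheorems (h3 : FLS2015_theorem3) (h4 : FLS2015_theorem4)
    (h91 : FLS2015_prop9_1c) (hKal : Kalyanswamy2018_theorem1_2)
    (hT : ∀ (F : Type) [Field F] [NumberField F] [IsTotallyReal F] (p : ℕ) [Fact p.Prime], p ≠ 2 →
      ∀ (E : WeierstrassCurve (𝓞 F)), E.Δ ≠ 0 →
        ∀ ρ : ModPGaloisRep F (ZMod p) 2, (E.baseChange F).IsTorsionGaloisRep p ρ →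
          FramedRep.IsAbsolutelyIrreducible ρ →
          ∀ (L : Type) [Field L] [Algebra F L] [IsCyclotomicExtension {p} F L],
            (∃ (k : Type) (_ : Field k) (f : ZMod p →+* k) (Q : GL (Fin 2) k),
                (∀ τ : absoluteGaloisGroup L,
                  Q * Matrix.GeneralLinearGroup.map f (FramedGaloisRep.restrictField L ρ τ) * Q⁻¹ ∈
                    Serre1972.diagonalSubgroup k) ∧
                ∃ τ : absoluteGaloisGroup L,
                  ((Q * Matrix.GeneralLinearGroup.map f (FramedGaloisRep.restrictField L ρ τ) *
                      Q⁻¹ : GL (Fin 2) k) : Matrix (Fin 2) (Fin 2) k) 0 0 ≠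
                    ((Q * Matrix.GeneralLinearGroup.map f (FramedGaloisRep.restrictField L ρ τ) *
                      Q⁻¹ : GL (Fin 2) k) : Matrix (Fin 2) (Fin 2) k) 1 1) →
            (∃ (M : Type) (_ : Field M) (_ : Algebra F M),
                Module.finrank F M = 2 ∧ IsTotallyReal M ∧ Nonempty (M →ₐ[F] L)) →
            IsAutomorphicOfWeightZero E) :
    Box2022_theorem1_3 :=
  Box2022_theorem1_3_of_theorem7_6 h3 h4 h91 hKal fun F _ _ _ h5 E hΔ hirr =>
    Thorne2016_theorem7_6_of_dihedralLifting h3 hT F h5 E hΔ hirr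

/-! ### Box 2022, Thm. 1.3 from FOUR lifting inputs (Prop. 9.1 (c) is now a theorem) -/

/-- **`Box2022_theorem1_3` closed modulo four printed lifting inputs** (2026-08-17): the input
`FLS2015_prop9_1c` of `Box2022_theorem1_3_of_liftingTheorems` is discharged by
`FLS2015_prop9_1c_holds` (`FLSResidualImageCriteriaProofs.lean`: FLS 2015, Prop. 9.1 (c) proved
from Lemma 4.2 and a kernel-checked identification of the index-`2` subgroups `H₁`, `H₂` of the
Cartan normalisers), leaving exactly the four automorphy lifting theorems `FLS2015_theorem3`,
`FLS2015_theorem4`, `Kalyanswamy2018_theorem1_2` and (T) = Thorne 2016, Thm. 7.5 for `ρ_{E,p}`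
(written out, as in `Box2022_theorem1_3_of_liftingTheorems`).
[cite: Box2022, Thm. 1.3 and its proof] [cite: FreitasLeHungSiksek2015, Prop. 9.1 (c)] -/
theorem Box2022_theorem1_3_of_fourLiftingTheorems (h3 : FLS2015_theorem3) (h4 : FLS2015_theorem4)
    (hKal : Kalyanswamy2018_theorem1_2)
    (hT : ∀ (F : Type) [Field F] [NumberField F] [IsTotallyReal F] (p : ℕ) [Fact p.Prime], p ≠ 2 →
      ∀ (E : WeierstrassCurve (𝓞 F)), E.Δ ≠ 0 →
        ∀ ρ : ModPGaloisRep F (ZMod p) 2, (E.baseChange F).IsTorsionGaloisRep p ρ →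
          FramedRep.IsAbsolutelyIrreducible ρ →
          ∀ (L : Type) [Field L] [Algebra F L] [IsCyclotomicExtension {p} F L],
            (∃ (k : Type) (_ : Field k) (f : ZMod p →+* k) (Q : GL (Fin 2) k),
                (∀ τ : absoluteGaloisGroup L,
                  Q * Matrix.GeneralLinearGroup.map f (FramedGaloisRep.restrictField L ρ τ) * Q⁻¹ ∈
                    Serre1972.diagonalSubgroup k) ∧
                ∃ τ : absoluteGaloisGroup L,
                  ((Q * Matrix.GeneralLinearGroup.map f (FramedGaloisRep.restrictField L ρ τ) *
                      Q⁻¹ : GL (Fin 2) k) : Matrix (Fin 2) (Fin 2) k) 0 0 ≠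
                    ((Q * Matrix.GeneralLinearGroup.map f (FramedGaloisRep.restrictField L ρ τ) *
                      Q⁻¹ : GL (Fin 2) k) : Matrix (Fin 2) (Fin 2) k) 1 1) →
            (∃ (M : Type) (_ : Field M) (_ : Algebra F M),
                Module.finrank F M = 2 ∧ IsTotallyReal M ∧ Nonempty (M →ₐ[F] L)) →
            IsAutomorphicOfWeightZero E) :
    Box2022_theorem1_3 :=
  Box2022_theorem1_3_of_liftingTheorems h3 h4 FLS2015_prop9_1c_holds hKal hT

/-- **Box 2022, Thm. 1.3 (iii) unconditionally reduced to the two lifting theorems at `7`**: for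
`K` totally real with `K ∩ ℚ(ζ₇) = ℚ` (the cubic `X³ + X² − 2X − 1` has no root in `K`) and
`E / 𝓞 K` (`Δ ≠ 0`) not automorphic of weight zero, some framing of `E[7]` is Borel or lands in
`G(e7)` — from `FLS2015_theorem4` and `Kalyanswamy2018_theorem1_2` alone (`Box2022.clause_seven`
with `FLS2015_prop9_1c_holds`). [cite: Box2022, Thm. 1.3 (iii) and its proof] -/
theorem Box2022.clause_seven_of_liftingTheorems (h4 : FLS2015_theorem4)
    (hKal : Kalyanswamy2018_theorem1_2) (K : Type) [Field K] [NumberField K] [IsTotallyReal K]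
    (E : WeierstrassCurve (𝓞 K)) (hΔ : E.Δ ≠ 0) (hne : ¬ IsAutomorphicOfWeightZero E)
    (hcubic : ∀ x : K, x ^ 3 + x ^ 2 - 2 * x - 1 ≠ 0) :
    ∃ ρ : FramedGaloisRep K (ZMod 7) 2, (E.baseChange K).IsTorsionGaloisRep 7 ρ ∧
      ((∀ σ : Field.absoluteGaloisGroup K,
          ((ρ σ : GL (Fin 2) (ZMod 7)) : Matrix (Fin 2) (Fin 2) (ZMod 7)) 1 0 = 0) ∨
        (∀ σ : Field.absoluteGaloisGroup K, (ρ σ : GL (Fin 2) (ZMod 7)) ∈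
          Subgroup.closure ({(⟨!![0, 5; 3, 0], !![0, 5; 3, 0], by decide, by decide⟩ :
              GL (Fin 2) (ZMod 7)),
            (⟨!![5, 0; 3, 2], !![3, 0; 6, 4], by decide, by decide⟩ : GL (Fin 2) (ZMod 7))} :
            Set (GL (Fin 2) (ZMod 7))))) :=
  Box2022.clause_seven h4 FLS2015_prop9_1c_holds hKal K E hΔ hne hcubic

end Literature.NumberTheory.Automorphic

end
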